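/-
Copyright (c) 2026 the pub-hodgecm-mathlib formalisation cell (harness21).  Prover seat hodgecm-mathlib-K2Liu-p09 (g7): Track B «K2-LIT»,
hLiu418 = stmt-HodgeConjecture-24832; LEAD F0P6-plan RULINGS M-158d «A7-val road (σ)» and σ19∕σ21 — `hne` organ, brick (N2): transport of witnesses along a
`P_Δ`-preserving automorphism (the Δ-similitude `Ad d_a`, K2Liu-p10 (g5) T1∕T2) and the «one of two theta images» upgrade of the ★ glue.
-/
import Summits.HodgeConjecture.HodgeConjecture.Theorems.K2LiuA7ValueSumWitness           -- ★ p861145 (`exists_witness_or_of_add`; brings ★ V8a, ★ V1d `exists_flatFamily`)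
import Summits.HodgeConjecture.HodgeConjecture.Theorems.K2LiuA7ValueLevelIndependence    -- ★ p861421 (N0) (`value_level_independent`)
import HarnessLib

/-!
# Crux `HLiu418`, road `K2_Liu`, organ A7-val, `hne` organ brick (N2): WITNESS TRANSPORT ALONG A `P_Δ`-PRESERVING AUTOMORPHISM; ONE THETA IMAGE SUFFICES

Cell `hodgecm-mathlib`, crux item hLiu418 = `stmt-HodgeConjecture-24832`; squad K2 ∕ K2Liu; prover K2Liu-p09 (g7), organ lead A7-val.  THEOREMS ONLY; lane
`--supports stmt-HodgeConjecture-24832` (count-neutral helper).  RANK-GENERIC, frame-free, every finite place; HYPOTHESIS-FIRST in an abstract continuous automorphism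
`θ : H_v ≃ₜ* H_v` with four laws BY VALUE — (θ1) `θ` preserves `P_Δ`, (θ2) `g ↦ g ∘ θ` preserves Siegel sections of `I_v(s, χ_v)`, (θ3) and smoothness, (θ4) the intertwining law
`M_v(s)(g ∘ θ)(h) = c_θ(s) · M_v(s)(g)(θ h)` with `c_θ` rational in `q_v^{-s}`, regular and non-zero at `½` — at the instance `θ := Ad d_a` (K2Liu-p10 (g5) ★∕📤 T1
`K2LiuDeltaSimilitudeGroup`, T2 `K2LiuDeltaSimilitudeIntertwining`; K2Liu-p07 (g3) ★ `K2LiuLocalSWSimilitude*`).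

* §1 **`exists_witness_comp`** — V8e's witness tuple `(f, Fn)` (flat ∕ smooth ∕ Siegel through `φ` for `K₀`, (A4′-R) datum, `Fn(½)(θ h₁) ≠ 0`) transports to a witness tuple
  through `φ ∘ θ` for the Iwasawa compact `θ⁻¹ K₀` with non-zero datum at `(½, h₁)` (`f ↦ f ∘ θ`, `Fn ↦ c_θ · Fn ∘ θ`); `θ⁻¹ K₀` is again compact open Iwasawa (`iwasawa_comap`).
* §2 **`exists_witness_of_exists_witness`** — LEVEL-FREENESS: a witness through `φ` for ONE Iwasawa compact gives one for EVERY Iwasawa compact (★ (N0) `value_level_independent`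
  + ★ V1d `exists_flatFamily` + `hA4R`).
* §3 **`exists_witness_mem_of_mem_sup`** — ONE THETA IMAGE SUFFICES: if `φ ∈ R₀ ⊔ R₁` (submodules of `I_v(½, χ_v)`) carries a witness and `R₁ ∘ θ ≤ R₀` (the similitude carries
  the second image onto the first: ★ `exists_mover_localSWImage_map_localCongr_dA`), then some `ψ ∈ R₀` carries a witness, for the SAME `K₀` (★ glue `exists_witness_or_of_add`,
  §1 at `h₁ = 1`, §2) — with ★ S1 (`I_v(½) ≤ R(dV′) ⊔ R(c₁•dV′)`) this is `hne` of the face (A4″-KR) at the space of record.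
HONEST LABEL.  `HC_CM` is proved only modulo the 7 printed citations (2 remaining named inputs: hLiu418 = `stmt-HodgeConjecture-24832`,
h413 = `stmt-HodgeConjecture-24833`) until rung 0 closes.

## References
* [KudlaSweet1997] S. Kudla, W. J. Sweet, Israel J. Math. 98 (1997), §1, Thm. 1.2.
* [Kudla1994] S. Kudla, Israel J. Math. 87 (1994), §2–§3 (similitudes of the doubled space).
* [MoeglinVignerasWaldspurger1987] C. Mœglin, M.-F. Vignéras, J.-L. Waldspurger, LNM 1291, Chap. 1 I.17, Chap. 2 II.1.
* [Casselman1980] W. Casselman, Compositio Math. 40 (1980), §3.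
-/

set_option autoImplicit false
set_option linter.dupNamespace false -- the mandated namespace repeats `HodgeConjecture.HodgeConjecture`

noncomputable section

open scoped Classical
open NumberField IsDedekindDomain MeasureTheory Topology
open Literature.NumberTheory.GaloisRepresentations.IsNonarchimedeanLocalField
open Literature.NumberTheory.Automorphic Literature.NumberTheory.Automorphic.UnitaryGroup
open Literature.NumberTheory.GelbartRogawski1991.UnitaryDualPair.LocalSplitting
open Literature.NumberTheory.K2Lit.LocalSiegelDoubled
open Summit.HodgeConjecture.HodgeConjecture.Cruxes.HLiu418.K2LiuQRationalDefs
open Summit.HodgeConjecture.HodgeConjecture.Cruxes.HLiu418.K2LiuLocalLFactorDefs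
open Summit.HodgeConjecture.HodgeConjecture.Cruxes.HLiu418.K2LiuLocalSiegel
open Summit.HodgeConjecture.HodgeConjecture.Cruxes.HLiu418.K2LiuA7ValueSiegelLaw
open Summit.HodgeConjecture.HodgeConjecture.Cruxes.HLiu418.K2LiuA7ValueSumWitness
open Summit.HodgeConjecture.HodgeConjecture.Cruxes.HLiu418.K2LiuA7ValueLevelIndependence

namespace Summit.HodgeConjecture.HodgeConjecture.Cruxes.HLiu418.K2LiuA7ValueWitnessTransport

variable (F : Type) [Field F] [NumberField F] (E : Type) [Field E] [NumberField E] [Algebra F E]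
  [Algebra.IsQuadraticExtension F E] (c : E ≃ₐ[F] E)
  {δ : E} (hcδ : c δ = -δ) (hδ : δ ≠ 0) {d : F} (hd : δ * δ = algebraMap F E d) (v : HeightOneSpectrum (𝓞 F)) (n : ℕ)
  {T₀ : Matrix (Fin n) (Fin n) F} (hT₀ : T₀.IsSymm) {JD : Matrix (Fin (n + n)) (Fin (n + n)) E} (hJD : JD = (gramD F n T₀).map (algebraMap F E))
  (χv : ∀ w : PlacesOver E v, (w.1.adicCompletion E)ˣ →* ℂˣ)
  [MeasurableSpace (unipDeltaLocal F E c v n (JD := JD))] (νN : Measure (unipDeltaLocal F E c v n (JD := JD))) (vol : ℝ)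

/-! ## §1 Transport of Iwasawa compacts and of witness tuples along `θ` -/

section Transport

variable (θ : UnitaryGroup.localPi E c (n + n) JD v ≃ₜ* UnitaryGroup.localPi E c (n + n) JD v)
  (hθP : ∀ p : UnitaryGroup.localPi E c (n + n) JD v, IsSiegelDelta F E c hcδ hδ hd v n hT₀ hJD p ↔ IsSiegelDelta F E c hcδ hδ hd v n hT₀ hJD (θ p))

omit [Algebra.IsQuadraticExtension F E] [MeasurableSpace (unipDeltaLocal F E c v n (JD := JD))] in
/-- `θ⁻¹ K₀` is compact open when `K₀` is. [cite: MoeglinVignerasWaldspurger1987, Chap. 2 II.1] -/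
theorem isCompact_isOpen_comap (K₀ : Subgroup (UnitaryGroup.localPi E c (n + n) JD v))
    (hK₀ : IsCompact (K₀ : Set (UnitaryGroup.localPi E c (n + n) JD v)) ∧ IsOpen (K₀ : Set (UnitaryGroup.localPi E c (n + n) JD v))) :
    IsCompact ((K₀.comap θ.toMulEquiv.toMonoidHom : Subgroup (UnitaryGroup.localPi E c (n + n) JD v)) : Set (UnitaryGroup.localPi E c (n + n) JD v)) ∧
      IsOpen ((K₀.comap θ.toMulEquiv.toMonoidHom : Subgroup (UnitaryGroup.localPi E c (n + n) JD v)) : Set (UnitaryGroup.localPi E c (n + n) JD v)) := by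
  have hset : ((K₀.comap θ.toMulEquiv.toMonoidHom : Subgroup (UnitaryGroup.localPi E c (n + n) JD v)) : Set (UnitaryGroup.localPi E c (n + n) JD v)) =
      θ.toHomeomorph ⁻¹' (K₀ : Set (UnitaryGroup.localPi E c (n + n) JD v)) := rfl
  rw [hset]
  exact ⟨θ.toHomeomorph.isCompact_preimage.2 hK₀.1, hK₀.2.preimage θ.toHomeomorph.continuous⟩

omit [MeasurableSpace (unipDeltaLocal F E c v n (JD := JD))] in
include hθP in
/-- **`θ⁻¹ K₀` is Iwasawa when `K₀` is** (`θ` preserves `P_Δ`). [cite: MoeglinVignerasWaldspurger1987, Chap. 2 II.1] [cite: Casselman1980, §3] -/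
theorem iwasawa_comap (K₀ : Subgroup (UnitaryGroup.localPi E c (n + n) JD v))
    (hIw : ∀ x : UnitaryGroup.localPi E c (n + n) JD v, ∃ p, IsSiegelDelta F E c hcδ hδ hd v n hT₀ hJD p ∧ ∃ k ∈ K₀, x = p * k) :
    ∀ x : UnitaryGroup.localPi E c (n + n) JD v, ∃ p, IsSiegelDelta F E c hcδ hδ hd v n hT₀ hJD p ∧
      ∃ k ∈ (K₀.comap θ.toMulEquiv.toMonoidHom : Subgroup (UnitaryGroup.localPi E c (n + n) JD v)), x = p * k := by
  intro x
  obtain ⟨p, hp, k, hk, hxk⟩ := hIw (θ x)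
  refine ⟨θ.symm p, (hθP (θ.symm p)).2 (by rw [θ.apply_symm_apply]; exact hp), θ.symm k, ?_, ?_⟩
  · rw [Subgroup.mem_comap]
    show θ (θ.symm k) ∈ K₀
    rw [θ.apply_symm_apply]; exact hk
  · apply θ.injective
    rw [map_mul, θ.apply_symm_apply, θ.apply_symm_apply]; exact hxk

variable (hθS : ∀ (s : ℂ) (g : UnitaryGroup.localPi E c (n + n) JD v → ℂ), IsLocalSiegelSection F E c hcδ hδ hd v n hT₀ hJD χv s g →
    IsLocalSiegelSection F E c hcδ hδ hd v n hT₀ hJD χv s (g ∘ θ))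
  (hθsm : ∀ g : UnitaryGroup.localPi E c (n + n) JD v → ℂ, IsSmooth F E c v n g → IsSmooth F E c v n (g ∘ θ))
  (cθ : ℂ → ℂ) (hcθ : IsQRationalRegularAt (residueFieldCard (v.adicCompletion F)) (1 / 2) cθ) (hcθ0 : cθ (1 / 2) ≠ 0)
  (hθM : ∀ (g : UnitaryGroup.localPi E c (n + n) JD v → ℂ) (s : ℂ), IsLocalSiegelSection F E c hcδ hδ hd v n hT₀ hJD χv s g → IsSmooth F E c v n g → 1 < s.re →
    ∀ h, localIntertwining F E c v n hJD νN (g ∘ θ) h = cθ s * localIntertwining F E c v n hJD νN g (θ h))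

include hθS hθsm hcθ hcθ0 hθM in
/-- **WITNESS TRANSPORT**: a `K₀`-flat smooth Siegel family `f` through `φ` with (A4′-R) datum `Fn`, `Fn(½)(θ h₁) ≠ 0`, gives the `θ⁻¹K₀`-flat family `f ∘ θ` through `φ ∘ θ` with
datum `c_θ · (Fn ∘ θ)`, non-zero at `(½, h₁)`. [cite: KudlaSweet1997, §1] [cite: Kudla1994, §3] [cite: Casselman1980, §3] -/
theorem exists_witness_comp (K₀ : Subgroup (UnitaryGroup.localPi E c (n + n) JD v)) (φ : UnitaryGroup.localPi E c (n + n) JD v → ℂ)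
    (h₁ : UnitaryGroup.localPi E c (n + n) JD v)
    (hW : ∃ f Fn : ℂ → UnitaryGroup.localPi E c (n + n) JD v → ℂ,
      (∀ s, IsLocalSiegelSection F E c hcδ hδ hd v n hT₀ hJD χv s (f s)) ∧ (∀ s, IsSmooth F E c v n (f s)) ∧ (∀ s s' : ℂ, ∀ k ∈ K₀, f s k = f s' k) ∧
      f (1 / 2) = φ ∧ (∀ h, IsQRationalRegularAt (residueFieldCard (v.adicCompletion F)) (1 / 2) fun s => Fn s h) ∧
      (∀ s : ℂ, 1 < s.re → ∀ h, localIntertwining F E c v n hJD νN (f s) h = aNorm F E c v n χv vol s * Fn s h) ∧ Fn (1 / 2) (θ h₁) ≠ 0) :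
    ∃ f Fn : ℂ → UnitaryGroup.localPi E c (n + n) JD v → ℂ,
      (∀ s, IsLocalSiegelSection F E c hcδ hδ hd v n hT₀ hJD χv s (f s)) ∧ (∀ s, IsSmooth F E c v n (f s)) ∧
      (∀ s s' : ℂ, ∀ k ∈ (K₀.comap θ.toMulEquiv.toMonoidHom : Subgroup (UnitaryGroup.localPi E c (n + n) JD v)), f s k = f s' k) ∧
      f (1 / 2) = φ ∘ θ ∧ (∀ h, IsQRationalRegularAt (residueFieldCard (v.adicCompletion F)) (1 / 2) fun s => Fn s h) ∧
      (∀ s : ℂ, 1 < s.re → ∀ h, localIntertwining F E c v n hJD νN (f s) h = aNorm F E c v n χv vol s * Fn s h) ∧ Fn (1 / 2) h₁ ≠ 0 := by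
  obtain ⟨f, Fn, hS, hsm, hfl, hthr, hreg, hfac, hne⟩ := hW
  refine ⟨fun s => f s ∘ θ, fun s h => cθ s * Fn s (θ h), fun s => hθS s _ (hS s), fun s => hθsm _ (hsm s), fun s s' k hk => ?_, ?_,
    fun h => hcθ.mul (hreg (θ h)), fun s hs h => ?_, mul_ne_zero hcθ0 hne⟩
  · rw [Subgroup.mem_comap] at hk
    exact hfl s s' (θ k) hk
  · funext x; show f (1 / 2) (θ x) = φ (θ x); rw [hthr]
  · rw [hθM _ s (hS s) (hsm s) hs h, hfac s hs (θ h), ← mul_assoc, mul_comm (cθ s), mul_assoc]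

end Transport

/-! ## §2 Level-freeness of witnesses -/

section Level

variable (haN : ∀ s : ℂ, 1 < s.re → aNorm F E c v n χv vol s ≠ 0)
  (K₀ K₀' : Subgroup (UnitaryGroup.localPi E c (n + n) JD v))
  (hK₀ : IsCompact (K₀ : Set (UnitaryGroup.localPi E c (n + n) JD v)) ∧ IsOpen (K₀ : Set (UnitaryGroup.localPi E c (n + n) JD v)))
  (hK₀' : IsCompact (K₀' : Set (UnitaryGroup.localPi E c (n + n) JD v)) ∧ IsOpen (K₀' : Set (UnitaryGroup.localPi E c (n + n) JD v)))
  (hIw : ∀ x : UnitaryGroup.localPi E c (n + n) JD v, ∃ p, IsSiegelDelta F E c hcδ hδ hd v n hT₀ hJD p ∧ ∃ k ∈ K₀, x = p * k)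
  (hIw' : ∀ x : UnitaryGroup.localPi E c (n + n) JD v, ∃ p, IsSiegelDelta F E c hcδ hδ hd v n hT₀ hJD p ∧ ∃ k ∈ K₀', x = p * k)
  -- the (A4′-R) face and the half-plane integrability for the TARGET compact `K₀′`
  (hA4R' : ∀ f' : ℂ → UnitaryGroup.localPi E c (n + n) JD v → ℂ, (∀ s, IsLocalSiegelSection F E c hcδ hδ hd v n hT₀ hJD χv s (f' s)) →
    (∀ s, IsSmooth F E c v n (f' s)) → (∀ s s' : ℂ, ∀ k ∈ K₀', f' s k = f' s' k) →
    ∃ Fn' : ℂ → UnitaryGroup.localPi E c (n + n) JD v → ℂ, (∀ h, IsQRationalRegularAt (residueFieldCard (v.adicCompletion F)) (1 / 2) fun s => Fn' s h) ∧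
      ∀ s : ℂ, 1 < s.re → ∀ h, localIntertwining F E c v n hJD νN (f' s) h = aNorm F E c v n χv vol s * Fn' s h)
  (hintA' : ∀ f' : ℂ → UnitaryGroup.localPi E c (n + n) JD v → ℂ, (∀ s, IsLocalSiegelSection F E c hcδ hδ hd v n hT₀ hJD χv s (f' s)) →
    (∀ s, IsSmooth F E c v n (f' s)) → (∀ s s' : ℂ, ∀ k ∈ K₀', f' s k = f' s' k) → ∀ s : ℂ, 1 < s.re → ∀ h,
      Integrable (fun u : unipDeltaLocal F E c v n (JD := JD) => f' s (weylDelta F E c v n hJD * (u : UnitaryGroup.localPi E c (n + n) JD v) * h)) νN)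

include hcδ hδ hd hT₀ hJD hK₀ hK₀' hIw hIw' hA4R' hintA' haN in
/-- **LEVEL-FREENESS OF WITNESSES**: a witness tuple through `φ ∈ I_v(½, χ_v)` for the Iwasawa compact `K₀` with non-zero datum at `(½, h₀)` gives one for `K₀′`
(★ V1d `exists_flatFamily` for `K₀′`, `hA4R′`, ★ (N0) `value_level_independent`). [cite: KudlaSweet1997, §1] [cite: Casselman1980, §3] -/
theorem exists_witness_of_exists_witness (φ : UnitaryGroup.localPi E c (n + n) JD v → ℂ)
    (hφ : φ ∈ localDegPS F E c hcδ hδ hd v n hT₀ hJD χv (1 / 2)) (h₀ : UnitaryGroup.localPi E c (n + n) JD v)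
    (hW : ∃ f Fn : ℂ → UnitaryGroup.localPi E c (n + n) JD v → ℂ,
      (∀ s, IsLocalSiegelSection F E c hcδ hδ hd v n hT₀ hJD χv s (f s)) ∧ (∀ s, IsSmooth F E c v n (f s)) ∧ (∀ s s' : ℂ, ∀ k ∈ K₀, f s k = f s' k) ∧
      f (1 / 2) = φ ∧ (∀ h, IsQRationalRegularAt (residueFieldCard (v.adicCompletion F)) (1 / 2) fun s => Fn s h) ∧
      (∀ s : ℂ, 1 < s.re → ∀ h, localIntertwining F E c v n hJD νN (f s) h = aNorm F E c v n χv vol s * Fn s h) ∧ Fn (1 / 2) h₀ ≠ 0) :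
    ∃ f Fn : ℂ → UnitaryGroup.localPi E c (n + n) JD v → ℂ,
      (∀ s, IsLocalSiegelSection F E c hcδ hδ hd v n hT₀ hJD χv s (f s)) ∧ (∀ s, IsSmooth F E c v n (f s)) ∧ (∀ s s' : ℂ, ∀ k ∈ K₀', f s k = f s' k) ∧
      f (1 / 2) = φ ∧ (∀ h, IsQRationalRegularAt (residueFieldCard (v.adicCompletion F)) (1 / 2) fun s => Fn s h) ∧
      (∀ s : ℂ, 1 < s.re → ∀ h, localIntertwining F E c v n hJD νN (f s) h = aNorm F E c v n χv vol s * Fn s h) ∧ Fn (1 / 2) h₀ ≠ 0 := by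
  obtain ⟨f, Fn, hS, hsm, hfl, hthr, hreg, hfac, hne⟩ := hW
  have hmem := hφ
  rw [mem_localDegPS_iff] at hmem
  obtain ⟨f', hS', hsm', hfl', hthr'⟩ := exists_flatFamily F E c hcδ hδ hd v n hT₀ hJD χv K₀' hK₀' hIw' (1 / 2) hmem.1 hmem.2
  obtain ⟨Fn', hreg', hfac'⟩ := hA4R' f' hS' hsm' hfl'
  refine ⟨f', Fn', hS', hsm', hfl', hthr', hreg', hfac', ?_⟩
  rw [value_level_independent F E c hcδ hδ hd v n hT₀ hJD χv νN vol haN K₀' K₀ hK₀' hK₀ hIw' hIw hA4R' hintA' f' Fn' hS' hsm' hfl' hreg' hfac'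
    f Fn hS hfl hreg hfac (hthr.trans hthr'.symm) h₀]
  exact hne

end Level

/-! ## §3 One theta image suffices -/

section Sup

variable (haN : ∀ s : ℂ, 1 < s.re → aNorm F E c v n χv vol s ≠ 0)
  (K₀ : Subgroup (UnitaryGroup.localPi E c (n + n) JD v))
  (hK₀ : IsCompact (K₀ : Set (UnitaryGroup.localPi E c (n + n) JD v)) ∧ IsOpen (K₀ : Set (UnitaryGroup.localPi E c (n + n) JD v)))
  (hIw : ∀ x : UnitaryGroup.localPi E c (n + n) JD v, ∃ p, IsSiegelDelta F E c hcδ hδ hd v n hT₀ hJD p ∧ ∃ k ∈ K₀, x = p * k)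
  (hA4R : ∀ f' : ℂ → UnitaryGroup.localPi E c (n + n) JD v → ℂ, (∀ s, IsLocalSiegelSection F E c hcδ hδ hd v n hT₀ hJD χv s (f' s)) →
    (∀ s, IsSmooth F E c v n (f' s)) → (∀ s s' : ℂ, ∀ k ∈ K₀, f' s k = f' s' k) →
    ∃ Fn' : ℂ → UnitaryGroup.localPi E c (n + n) JD v → ℂ, (∀ h, IsQRationalRegularAt (residueFieldCard (v.adicCompletion F)) (1 / 2) fun s => Fn' s h) ∧
      ∀ s : ℂ, 1 < s.re → ∀ h, localIntertwining F E c v n hJD νN (f' s) h = aNorm F E c v n χv vol s * Fn' s h)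
  (hintA : ∀ f' : ℂ → UnitaryGroup.localPi E c (n + n) JD v → ℂ, (∀ s, IsLocalSiegelSection F E c hcδ hδ hd v n hT₀ hJD χv s (f' s)) →
    (∀ s, IsSmooth F E c v n (f' s)) → (∀ s s' : ℂ, ∀ k ∈ K₀, f' s k = f' s' k) → ∀ s : ℂ, 1 < s.re → ∀ h,
      Integrable (fun u : unipDeltaLocal F E c v n (JD := JD) => f' s (weylDelta F E c v n hJD * (u : UnitaryGroup.localPi E c (n + n) JD v) * h)) νN)
  (θ : UnitaryGroup.localPi E c (n + n) JD v ≃ₜ* UnitaryGroup.localPi E c (n + n) JD v)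
  (hθP : ∀ p : UnitaryGroup.localPi E c (n + n) JD v, IsSiegelDelta F E c hcδ hδ hd v n hT₀ hJD p ↔ IsSiegelDelta F E c hcδ hδ hd v n hT₀ hJD (θ p))
  (hθS : ∀ (s : ℂ) (g : UnitaryGroup.localPi E c (n + n) JD v → ℂ), IsLocalSiegelSection F E c hcδ hδ hd v n hT₀ hJD χv s g →
    IsLocalSiegelSection F E c hcδ hδ hd v n hT₀ hJD χv s (g ∘ θ))
  (hθsm : ∀ g : UnitaryGroup.localPi E c (n + n) JD v → ℂ, IsSmooth F E c v n g → IsSmooth F E c v n (g ∘ θ))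
  (cθ : ℂ → ℂ) (hcθ : IsQRationalRegularAt (residueFieldCard (v.adicCompletion F)) (1 / 2) cθ) (hcθ0 : cθ (1 / 2) ≠ 0)
  (hθM : ∀ (g : UnitaryGroup.localPi E c (n + n) JD v → ℂ) (s : ℂ), IsLocalSiegelSection F E c hcδ hδ hd v n hT₀ hJD χv s g → IsSmooth F E c v n g → 1 < s.re →
    ∀ h, localIntertwining F E c v n hJD νN (g ∘ θ) h = cθ s * localIntertwining F E c v n hJD νN g (θ h))

include hcδ hδ hd hT₀ hJD hK₀ hIw hA4R hintA haN hθP hθS hθsm hcθ hcθ0 hθM in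
/-- **ONE THETA IMAGE SUFFICES.**  Let `R₀, R₁ ≤ I_v(½, χ_v)` with `R₁ ∘ θ ≤ R₀` (every `φ₁ ∈ R₁` has `φ₁ ∘ θ ∈ R₀` — the Δ-similitude carries the second theta image onto
the first).  If `φ = φ₀ + φ₁` (`φ₀ ∈ R₀`, `φ₁ ∈ R₁`) carries a `K₀`-witness with non-zero datum at `(½, 1)`, then some `ψ ∈ R₀` carries a `K₀`-witness with non-zero datum at
`(½, 1)` (★ glue; in the `R₁` case transport along `θ` to `θ⁻¹K₀` — `θ 1 = 1` — then back to `K₀` by level-freeness). [cite: KudlaSweet1997, §1, Thm. 1.2] [cite: Kudla1994, §3] -/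
theorem exists_witness_mem_of_add (R₀ : Submodule ℂ (UnitaryGroup.localPi E c (n + n) JD v → ℂ))
    (hR₀ : R₀ ≤ localDegPS F E c hcδ hδ hd v n hT₀ hJD χv (1 / 2))
    (φ₀ φ₁ : UnitaryGroup.localPi E c (n + n) JD v → ℂ) (hφ₀ : φ₀ ∈ R₀) (hφ₁ : φ₁ ∈ localDegPS F E c hcδ hδ hd v n hT₀ hJD χv (1 / 2)) (hφ₁θ : φ₁ ∘ θ ∈ R₀)
    (hW : ∃ f Fn : ℂ → UnitaryGroup.localPi E c (n + n) JD v → ℂ,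
      (∀ s, IsLocalSiegelSection F E c hcδ hδ hd v n hT₀ hJD χv s (f s)) ∧ (∀ s, IsSmooth F E c v n (f s)) ∧ (∀ s s' : ℂ, ∀ k ∈ K₀, f s k = f s' k) ∧
      f (1 / 2) = φ₀ + φ₁ ∧ (∀ h, IsQRationalRegularAt (residueFieldCard (v.adicCompletion F)) (1 / 2) fun s => Fn s h) ∧
      (∀ s : ℂ, 1 < s.re → ∀ h, localIntertwining F E c v n hJD νN (f s) h = aNorm F E c v n χv vol s * Fn s h) ∧ Fn (1 / 2) 1 ≠ 0) :
    ∃ ψ ∈ R₀, ∃ f Fn : ℂ → UnitaryGroup.localPi E c (n + n) JD v → ℂ,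
      (∀ s, IsLocalSiegelSection F E c hcδ hδ hd v n hT₀ hJD χv s (f s)) ∧ (∀ s, IsSmooth F E c v n (f s)) ∧ (∀ s s' : ℂ, ∀ k ∈ K₀, f s k = f s' k) ∧
      f (1 / 2) = ψ ∧ (∀ h, IsQRationalRegularAt (residueFieldCard (v.adicCompletion F)) (1 / 2) fun s => Fn s h) ∧
      (∀ s : ℂ, 1 < s.re → ∀ h, localIntertwining F E c v n hJD νN (f s) h = aNorm F E c v n χv vol s * Fn s h) ∧ Fn (1 / 2) 1 ≠ 0 := by
  obtain ⟨f, Fn, hS, hsm, hfl, hthr, hreg, hfac, hne⟩ := hW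
  -- the glue on the two summands, as members of `I_v(½, χ_v)`
  have hor := exists_witness_or_of_add F E c hcδ hδ hd v n hT₀ hJD χv νN vol haN K₀ hK₀ hIw hA4R hintA ⟨φ₀, hR₀ hφ₀⟩ ⟨φ₁, hφ₁⟩ f Fn hS hsm hfl
    (by rw [hthr]; rfl) hreg hfac 1 hne
  rcases hor with ⟨f₀, Fn₀, hS₀, hsm₀, hfl₀, hthr₀, hreg₀, hfac₀, hne₀⟩ | ⟨f₁, Fn₁, hS₁, hsm₁, hfl₁, hthr₁, hreg₁, hfac₁, hne₁⟩
  · exact ⟨φ₀, hφ₀, f₀, Fn₀, hS₀, hsm₀, hfl₀, hthr₀, hreg₀, hfac₀, hne₀⟩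
  · -- transport the `R₁`-witness along `θ` to a `θ⁻¹K₀`-witness through `φ₁ ∘ θ ∈ R₀` (`θ 1 = 1`), then back to `K₀`
    have hne₁' : Fn₁ (1 / 2) (θ 1) ≠ 0 := by rw [map_one]; exact hne₁
    have hW₁ := exists_witness_comp F E c hcδ hδ hd v n hT₀ hJD χv νN vol θ hθS hθsm cθ hcθ hcθ0 hθM K₀ φ₁ 1
      ⟨f₁, Fn₁, hS₁, hsm₁, hfl₁, hthr₁, hreg₁, hfac₁, hne₁'⟩
    refine ⟨φ₁ ∘ θ, hφ₁θ, exists_witness_of_exists_witness F E c hcδ hδ hd v n hT₀ hJD χv νN vol haN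
      (K₀.comap θ.toMulEquiv.toMonoidHom) K₀ (isCompact_isOpen_comap F E c v n θ K₀ hK₀) hK₀
      (iwasawa_comap F E c hcδ hδ hd v n hT₀ hJD θ hθP K₀ hIw) hIw hA4R hintA (φ₁ ∘ θ) (hR₀ hφ₁θ) 1 hW₁⟩

include hcδ hδ hd hT₀ hJD hK₀ hIw hA4R hintA haN hθP hθS hθsm hcθ hcθ0 hθM in
/-- **ONE THETA IMAGE SUFFICES, `⊔`-form**: `R₀, R₁ ≤ I_v(½, χ_v)`, `R₁ ∘ θ ≤ R₀`, `φ ∈ R₀ ⊔ R₁` with a `K₀`-witness non-zero at `(½, 1)` ⇒ some `ψ ∈ R₀` has one.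
With ★ S1 (`I_v(½) ≤ R(dV′) ⊔ R(c₁ • dV′)`) and ★ `localSWImage(c₁•dV′) = D_{c₁}(localSWImage dV′)`, this is `hne` of the face (A4″-KR) at the record space.
[cite: KudlaSweet1997, §1, Thm. 1.2] [cite: Kudla1994, §3] -/
theorem exists_witness_mem_of_mem_sup (R₀ R₁ : Submodule ℂ (UnitaryGroup.localPi E c (n + n) JD v → ℂ))
    (hR₀ : R₀ ≤ localDegPS F E c hcδ hδ hd v n hT₀ hJD χv (1 / 2)) (hR₁ : R₁ ≤ localDegPS F E c hcδ hδ hd v n hT₀ hJD χv (1 / 2))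
    (hR₁θ : ∀ φ₁ ∈ R₁, φ₁ ∘ θ ∈ R₀)
    (φ : UnitaryGroup.localPi E c (n + n) JD v → ℂ) (hφ : φ ∈ R₀ ⊔ R₁)
    (hW : ∃ f Fn : ℂ → UnitaryGroup.localPi E c (n + n) JD v → ℂ,
      (∀ s, IsLocalSiegelSection F E c hcδ hδ hd v n hT₀ hJD χv s (f s)) ∧ (∀ s, IsSmooth F E c v n (f s)) ∧ (∀ s s' : ℂ, ∀ k ∈ K₀, f s k = f s' k) ∧
      f (1 / 2) = φ ∧ (∀ h, IsQRationalRegularAt (residueFieldCard (v.adicCompletion F)) (1 / 2) fun s => Fn s h) ∧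
      (∀ s : ℂ, 1 < s.re → ∀ h, localIntertwining F E c v n hJD νN (f s) h = aNorm F E c v n χv vol s * Fn s h) ∧ Fn (1 / 2) 1 ≠ 0) :
    ∃ ψ ∈ R₀, ∃ f Fn : ℂ → UnitaryGroup.localPi E c (n + n) JD v → ℂ,
      (∀ s, IsLocalSiegelSection F E c hcδ hδ hd v n hT₀ hJD χv s (f s)) ∧ (∀ s, IsSmooth F E c v n (f s)) ∧ (∀ s s' : ℂ, ∀ k ∈ K₀, f s k = f s' k) ∧
      f (1 / 2) = ψ ∧ (∀ h, IsQRationalRegularAt (residueFieldCard (v.adicCompletion F)) (1 / 2) fun s => Fn s h) ∧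
      (∀ s : ℂ, 1 < s.re → ∀ h, localIntertwining F E c v n hJD νN (f s) h = aNorm F E c v n χv vol s * Fn s h) ∧ Fn (1 / 2) 1 ≠ 0 := by
  obtain ⟨φ₀, hφ₀, φ₁, hφ₁, rfl⟩ := Submodule.mem_sup.1 hφ
  exact exists_witness_mem_of_add F E c hcδ hδ hd v n hT₀ hJD χv νN vol haN K₀ hK₀ hIw hA4R hintA θ hθP hθS hθsm cθ hcθ hcθ0 hθM R₀ hR₀ φ₀ φ₁ hφ₀
    (hR₁ hφ₁) (hR₁θ φ₁ hφ₁) hW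

end Sup

end Summit.HodgeConjecture.HodgeConjecture.Cruxes.HLiu418.K2LiuA7ValueWitnessTransport

end
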